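import Mathlib.Analysis.InnerProductSpace.PiL2
import Literature.Analysis.FunctionSpaces.Complexify
import Literature.Analysis.FunctionSpaces.FourierSobolevNorm
import Literature.Analysis.FunctionSpaces.LittlewoodPaley
import Literature.Analysis.FunctionSpaces.BMO
import HarnessLib

-- provenance: harness21/H21/H21/Statements/NS/CriticalSpaces.lean @ b774093 (interim HEAD d8f2665); M5 mechanical rewrite
/-!
# Navier–Stokes scaling and the chain of critical spaces on `ℝ³`
(family: NS, statement **ns.S16**; trunk Sobolev, outline `H21/Outlines/Sobolev.md`, tier-L item
`NSCriticalSpaces`; namespace `Literature.NS`, coexisting with the accepted `Statements/NS/Wave0.lean`)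

The Navier–Stokes equations on `ℝ³` are invariant under the scaling
`u ↦ u_λ`, `u_λ(t, x) = λ u(λ² t, λ x)` (`λ > 0`), acting on initial data by
`u₀ ↦ λ u₀(λ ·)`. A Banach space of data whose norm is invariant under this action is called
*critical*; the classical chain of critical spaces is
`Ḣ^{1/2}(ℝ³) ⊂ L³(ℝ³) ⊂ Ḃ^{-1+3/p}_{p,∞}(ℝ³) (3 < p < ∞) ⊂ BMO⁻¹(ℝ³) ⊂ Ḃ^{-1}_{∞,∞}(ℝ³)`
(Cannone 1995; Koch–Tataru 2001, §1; Bourgain–Pavlović 2008, §1). This file records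

* the scaling maps `NS.rescale`, `NS.rescaleData` (and the `𝓢'`-level `NS.rescaleDistrib`);
* the scale invariance of each of the four norms `Ḣ^{1/2}`, `L³`, `Ḃ^{-1+3/p}_{p,q}`, `BMO⁻¹`;
* the four inclusions of the chain, and Cannone's example `‖x‖⁻¹` showing `L³ ≠ Ḃ^{-1+3/p}_{p,∞}`.

## Sources

* M. Cannone, *Ondelettes, paraproduits et Navier–Stokes*, Diderot (1995); and *Harmonic analysis
  tools for solving the incompressible Navier–Stokes equations*, Handbook of Mathematical Fluid
  Dynamics III (2004), §3, §7.
* H. Koch, D. Tataru, *Well-posedness for the Navier–Stokes equations*, Adv. Math. 157 (2001), §1.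
* J. Bourgain, N. Pavlović, *Ill-posedness of the Navier–Stokes equations in a critical space in
  3D*, J. Funct. Anal. 255 (2008), §1.
* H. Bahouri, J.-Y. Chemin, R. Danchin, *Fourier Analysis and Nonlinear PDE* (2011) ("BCD"),
  Prop. 2.20, Thm. 2.34, Prop. 2.39, §5.6.

## H21 / Mathlib anchors

* `Literature.Analysis.FunctionSpaces.EuclideanSpace.complexify` (`Prelude/Sobolev/Complexify.lean`): real vector fields
  `u₀ : ℝ³ → ℝ³` enter Fourier-based classes as `complexify ∘ u₀ : ℝ³ → ℂ³`.
* `Function.eHomSobolevSeminorm`, `Literature.Analysis.FunctionSpaces.MemHomSobolev` (`Prelude/Sobolev/FourierSobolevNorm.lean`)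
  for `Ḣ^{1/2}`; Mathlib's `MeasureTheory.eLpNorm`, `MeasureTheory.MemLp` for `L³`.
* `Literature.Analysis.FunctionSpaces.eHomBesovNorm`, `Literature.Analysis.FunctionSpaces.MemHomBesov`, `Literature.Analysis.FunctionSpaces.distribDilate`
  (`Prelude/Sobolev/LittlewoodPaley.lean`) for the homogeneous Besov spaces on `𝓢'(ℝ³, ℂ³)`.
* `Literature.Analysis.FunctionSpaces.MemBMOInvVec`, `Literature.Analysis.FunctionSpaces.eBMOInvNorm` (`Prelude/Sobolev/BMO.lean`) for `BMO⁻¹`.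
* Mathlib has no Navier–Stokes scaling map and no notion of critical space (searched `rescale`,
  `selfSimilar`, `dilat` in `Mathlib/Analysis`); tempered distributions `𝓢'(E, F)` and the
  embeddings `MeasureTheory.Lp.toTemperedDistribution`,
  `Function.HasTemperateGrowth.toTemperedDistribution` are Mathlib's
  (`Mathlib/Analysis/Distribution/TemperedDistribution.lean`).

## Design choices

* **Hand-over flag.** `NS.rescale` / `NS.rescaleData` are the T-FLUID notion
  `scaling_selfsimilar_ancient` at glue level; they are kept minimal here (plain functions, no
  solution theory). They coincide definitionally (`rfl`) with `Fluid.nsRescale` /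
  `Fluid.nsRescaleData` of `Literature/Analysis/FluidPDE/SelfSimilar.lean` (which are more
  general, `E → F`, and carry the pressure/force API; the `rfl` bridges are in
  `CriticalRegularity.lean`); merging the two copies is left to a librarian refactor. They are
  written for a general real normed space `E`.
* **Facts and derived theorems.** The literature results that are not proved here are named
  facts (`Prop` definitions): `exists_isDistributionOf_of_memLp_three`, `eBMOInvNorm_rescaleData`
  and the four inclusions / the strictness example of the chain. Everything that follows from
  facts already stated in the imported function-space files is a *theorem* taking those facts as
  explicit hypotheses: `eHomSobolevSeminorm_half_rescaleData` (from
  `Literature.Analysis.FunctionSpaces.eHomSobolevSeminorm_comp_smul`), `eHomBesovNorm_rescaleData` / `memHomBesov_rescaleData`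
  (from `Literature.Analysis.FunctionSpaces.eHomBesovNorm_distribDilate` / `Literature.Analysis.FunctionSpaces.MemHomBesov.distribDilate`),
  `memBMOInvVec_rescaleData` (from `eBMOInvNorm_rescaleData` and
  `Literature.Analysis.FunctionSpaces.memBMOInv_iff_eBMOInvNorm_lt_top`), `memLp_three_of_memHomSobolev_half` (from
  `Literature.Analysis.FunctionSpaces.eLpNorm_three_le_eHomSobolevSeminorm_half`), together with the small homogeneity lemmas
  for `Ḣ^s`, `eLpNormDistrib` and `Ḃ^s_{p,q}` under scalars proved below. The change of
  variables `IsDistributionOf.rescaleData` and the `L³` invariance are proved outright.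
* The four function spaces live on three different carriers in the accepted Prelude (functions
  `ℝ³ → ℂ³` for `Ḣ^s`, functions `ℝ³ → ℝ³`/`ℝ³ → ℝ` for `L³` and `BMO⁻¹`, tempered distributions
  `𝓢'(ℝ³, ℂ³)` for Besov). Since Mathlib has no `L¹_loc → 𝓢'` embedding, the passage from a
  vector field `u₀` to its distribution `U` is the *predicate* `NS.IsDistributionOf u₀ U`
  (`U φ = ∫ φ • complexify ∘ u₀`), exactly as in `Literature.Analysis.FunctionSpaces.MemBMOInv.memHomBesov_neg_one_top`; the
  Besov-side statements take `U` and `hU : IsDistributionOf u₀ U` as hypotheses. This avoids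
  proof terms (`MemLp.toLp`) inside statements and the missing instance `Fact (1 ≤ (3 : ℝ≥0∞))`.
* Scale invariance of the Besov norm is stated for *dyadic* `λ = 2^{j₀}` where it is an exact
  equality for the Littlewood–Paley norm of `LittlewoodPaley.lean` (`eHomBesovNorm_distribDilate`);
  for general `λ > 0` it only holds up to constants (BCD Rem. 2.19).
* For `p = ∞`, `p.toReal = 0` and Lean's `3 / 0 = 0` gives the regularity index `-1 + 3/p = -1`,
  which is the correct value `Ḃ^{-1}_{∞,∞}`; no separate case is needed.
-/

noncomputable section

open MeasureTheory TemperedDistribution Filter Topology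
open scoped SchwartzMap ENNReal NNReal RealInnerProductSpace

namespace Literature.Analysis.FluidPDE

/-! ## The Navier–Stokes scaling -/

section Rescale

variable {E : Type*} [NormedAddCommGroup E] [NormedSpace ℝ E]

/-- **ns.S16** (Navier–Stokes scaling; Cannone 1995, Koch–Tataru 2001 §1). The parabolic rescaling
of a space-time velocity field `u : ℝ → E → E` (time first) by `c : ℝ`:
`(rescale c u) t x = c • u (c² t) (c x)`. If `u` solves Navier–Stokes on `ℝ³`, so does
`rescale c u` for every `c > 0`.
*Glue-level definition of the T-FLUID notion `scaling_selfsimilar_ancient`, kept minimal and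
flagged for hand-over to the T-FLUID architect (G12), who owns Navier–Stokes scaling
(outline `Sobolev.md`, §4.6).* [cite: KochTataru2001, §1] -/
def rescale (c : ℝ) (u : ℝ → E → E) : ℝ → E → E := fun t x => c • u (c ^ 2 * t) (c • x)

/-- **ns.S16** (Navier–Stokes scaling of initial data; Cannone 1995, Koch–Tataru 2001 §1).
The rescaling of a velocity field `u₀ : E → E` by `c : ℝ`: `(rescaleData c u₀) x = c • u₀ (c x)`,
the time-zero slice of `rescale`.
*Glue-level definition of the T-FLUID notion `scaling_selfsimilar_ancient`, kept minimal and
flagged for hand-over to the T-FLUID architect (G12) (outline `Sobolev.md`, §4.6).* [cite: KochTataru2001, §1] -/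
def rescaleData (c : ℝ) (u₀ : E → E) : E → E := fun x => c • u₀ (c • x)

/-- Unfolding `rescale` (Koch–Tataru 2001, §1). [cite: KochTataru2001, §1] -/
@[simp]
theorem rescale_apply (c : ℝ) (u : ℝ → E → E) (t : ℝ) (x : E) :
    rescale c u t x = c • u (c ^ 2 * t) (c • x) := rfl

/-- Unfolding `rescaleData` (Koch–Tataru 2001, §1). [cite: KochTataru2001, §1] -/
@[simp]
theorem rescaleData_apply (c : ℝ) (u₀ : E → E) (x : E) :
    rescaleData c u₀ x = c • u₀ (c • x) := rfl

/-- The time-zero slice of the rescaled field is the rescaled datum: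
`rescale c u 0 = rescaleData c (u 0)` (Koch–Tataru 2001, §1). [cite: KochTataru2001, §1] -/
@[simp]
theorem rescale_zero (c : ℝ) (u : ℝ → E → E) : rescale c u 0 = rescaleData c (u 0) := by
  funext x
  simp

/-- Rescaling by `1` is the identity (Koch–Tataru 2001, §1). [cite: KochTataru2001, §1] -/
@[simp]
theorem rescaleData_one (u₀ : E → E) : rescaleData 1 u₀ = u₀ := by
  funext x
  simp

/-- Rescaling by `1` is the identity (Koch–Tataru 2001, §1). [cite: KochTataru2001, §1] -/
@[simp]
theorem rescale_one (u : ℝ → E → E) : rescale 1 u = u := by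
  funext t x
  simp

/-- The rescalings form an action of the multiplicative monoid of `ℝ`:
`rescaleData (a * b) u₀ = rescaleData b (rescaleData a u₀)` (Koch–Tataru 2001, §1). [cite: KochTataru2001, §1] -/
theorem rescaleData_mul (a b : ℝ) (u₀ : E → E) :
    rescaleData (a * b) u₀ = rescaleData b (rescaleData a u₀) := by
  funext x
  simp only [rescaleData_apply, smul_smul, mul_comm b a]

/-- The rescalings form an action of the multiplicative monoid of `ℝ`:
`rescale (a * b) u = rescale b (rescale a u)` (Koch–Tataru 2001, §1). [cite: KochTataru2001, §1] -/
theorem rescale_mul (a b : ℝ) (u : ℝ → E → E) :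
    rescale (a * b) u = rescale b (rescale a u) := by
  funext t x
  simp only [rescale_apply, smul_smul, mul_comm b a]
  congr 2
  ring

end Rescale

/-! ## Rescaling of tempered distributions and the passage `u₀ ↦ U` -/

section Distrib

variable {E F : Type*} [NormedAddCommGroup E] [NormedSpace ℝ E] [NormedAddCommGroup F]
  [NormedSpace ℂ F]

/-- The Navier–Stokes rescaling `U ↦ c • U(c ·)` of a tempered distribution by `c ∈ ℝˣ`, the
`𝓢'`-level counterpart of `rescaleData` built from `Literature.Analysis.FunctionSpaces.distribDilate` (Koch–Tataru 2001, §1;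
BCD §1.2.1). Needed to state scale invariance of the Besov norms, which live on `𝓢'`. [cite: KochTataru2001, §1] -/
def rescaleDistrib (c : ℝˣ) : 𝓢'(E, F) →L[ℂ] 𝓢'(E, F) := ((c : ℝ) : ℂ) • FunctionSpaces.distribDilate c

/-- Unfolding `rescaleDistrib` (Koch–Tataru 2001, §1). [cite: KochTataru2001, §1] -/
theorem rescaleDistrib_apply (c : ℝˣ) (U : 𝓢'(E, F)) :
    rescaleDistrib c U = ((c : ℝ) : ℂ) • FunctionSpaces.distribDilate c U := rfl

end Distrib

section IsDistributionOf

variable {ι : Type*} [Fintype ι] {E : Type*} [NormedAddCommGroup E] [NormedSpace ℝ E]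
  [MeasureSpace E]

/-- `IsDistributionOf u₀ U`: the tempered distribution `U ∈ 𝓢'(E, ℂ^ι)` is given by integration
against the (complexified) real vector field `u₀ : E → ℝ^ι`, i.e. `φ • complexify ∘ u₀` is
integrable and `U φ = ∫ φ x • complexify (u₀ x) dx` for every Schwartz `φ`. This predicate stands
in for the embedding `L¹_loc ∩ 𝓢' → 𝓢'` that Mathlib lacks (same device as
`Literature.Analysis.FunctionSpaces.MemBMOInv.memHomBesov_neg_one_top`); for `u₀ ∈ L^p` it is satisfied by Mathlib's
`MeasureTheory.Lp.toTemperedDistribution` of `complexify ∘ u₀` (BCD §1.2, `L^p ⊂ 𝓢'`). [folklore] -/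
def IsDistributionOf (u₀ : E → EuclideanSpace ℝ ι) (U : 𝓢'(E, EuclideanSpace ℂ ι)) : Prop :=
  ∀ φ : 𝓢(E, ℂ), Integrable (fun x => φ x • FunctionSpaces.EuclideanSpace.complexify (u₀ x)) ∧
    U φ = ∫ x, φ x • FunctionSpaces.EuclideanSpace.complexify (u₀ x)

/-- The zero distribution is the distribution of the zero field (BCD §1.2). [folklore] -/
theorem isDistributionOf_zero :
    IsDistributionOf (0 : E → EuclideanSpace ℝ ι) (0 : 𝓢'(E, EuclideanSpace ℂ ι)) := fun φ => by
  simp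

/-- A field has at most one tempered distribution (BCD §1.2). [folklore] -/
theorem IsDistributionOf.unique {u₀ : E → EuclideanSpace ℝ ι} {U V : 𝓢'(E, EuclideanSpace ℂ ι)}
    (hU : IsDistributionOf u₀ U) (hV : IsDistributionOf u₀ V) : U = V := by
  ext φ
  rw [(hU φ).2, (hV φ).2]

end IsDistributionOf

/-! ## Scale invariance of the critical norms on `ℝ³` -/

section Invariance

/-- Local notation for physical space `ℝ³ = EuclideanSpace ℝ (Fin 3)`. -/
local notation "ℝ³" => EuclideanSpace ℝ (Fin 3)

/-- Local notation for the complexified target `ℂ³ = EuclideanSpace ℂ (Fin 3)`. -/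
local notation "ℂ³" => EuclideanSpace ℂ (Fin 3)

open FunctionSpaces.EuclideanSpace (complexify)

/-- The distribution of rescaled data is the rescaled distribution: if `U` is the distribution of
`u₀ : ℝ³ → ℝ³` then `rescaleDistrib c U = c • U(c ·)` is the distribution of
`rescaleData c u₀ = c • u₀(c ·)` (change of variables `Measure.integral_comp_smul` against the
dilated test function `φ(c⁻¹ ·)`; BCD §1.2.1). [folklore] -/
theorem IsDistributionOf.rescaleData {u₀ : ℝ³ → ℝ³} {U : 𝓢'(ℝ³, ℂ³)} (hU : IsDistributionOf u₀ U)
    (c : ℝˣ) : IsDistributionOf (FluidPDE.rescaleData c u₀) (rescaleDistrib c U) := by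
  intro φ
  have hc : (c : ℝ) ≠ 0 := c.ne_zero
  -- the dilated test function `ψ = φ (c⁻¹ ·)` and the integrand `G = ψ • u₀` of `U ψ`
  set ψ : 𝓢(ℝ³, ℂ) := SchwartzMap.compCLMOfContinuousLinearEquiv ℂ
    (ContinuousLinearEquiv.smulLeft (c⁻¹ : ℝˣ) : ℝ³ ≃L[ℝ] ℝ³) φ with hψdef
  have hψ : ∀ y, ψ y = φ ((c : ℝ)⁻¹ • y) := fun y => by
    show φ (ContinuousLinearEquiv.smulLeft (c⁻¹ : ℝˣ) y) = _
    rw [ContinuousLinearEquiv.smulLeft_apply_apply, Units.smul_def, Units.val_inv_eq_inv_val]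
  obtain ⟨hint, hUψ⟩ := hU ψ
  set G : ℝ³ → ℂ³ := fun y => ψ y • complexify (u₀ y) with hGdef
  have hGx : ∀ x : ℝ³, φ x • complexify (FluidPDE.rescaleData c u₀ x) =
      ((c : ℝ) : ℂ) • G ((c : ℝ) • x) := fun x => by
    simp only [hGdef, rescaleData_apply, map_smul, hψ, smul_smul, inv_mul_cancel₀ hc, one_smul]
    rw [← Complex.coe_smul, smul_comm, smul_smul]
  simp_rw [hGx]
  refine ⟨((integrable_comp_smul_iff volume G hc).2 hint).smul ((c : ℝ) : ℂ), ?_⟩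
  rw [integral_smul, Measure.integral_comp_smul, ← hUψ, rescaleDistrib_apply, smul_apply,
    FunctionSpaces.distribDilate_apply_apply, finrank_euclideanSpace_fin, ← Complex.coe_smul]
  congr 1
  rw [hψdef, map_inv, inv_pow, abs_inv, abs_pow]

/-- An `L³` vector field on `ℝ³` has a tempered distribution (Hölder: `φ • u₀ ∈ L¹` for Schwartz
`φ ∈ L^{3/2}`; BCD §1.2, `L^p ⊂ 𝓢'`; Mathlib `MeasureTheory.Lp.toTemperedDistribution`). [cite: BahouriCheminDanchin2011, §1.2] -/
def exists_isDistributionOf_of_memLp_three : Prop :=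
  ∀ {u₀ : ℝ³ → ℝ³} (hu : MemLp u₀ 3 volume),
    ∃ U : 𝓢'(ℝ³, ℂ³), IsDistributionOf u₀ U

/-! ### `Ḣ^{1/2}` -/

/-- The homogeneous Sobolev seminorm of an `L²` function is absolutely homogeneous:
`‖a • f‖_{Ḣ^s} = ‖a‖ ‖f‖_{Ḣ^s}` (the `L²` Fourier transform is `ℂ`-linear; BCD Def. 1.31). [folklore] -/
theorem eHomSobolevSeminorm_const_smul (s : ℝ) (a : ℂ) (f : Lp ℂ³ 2 (volume : Measure ℝ³)) :
    Literature.Analysis.FunctionSpaces.eHomSobolevSeminorm s (a • f) = ‖a‖ₑ * Literature.Analysis.FunctionSpaces.eHomSobolevSeminorm s f := by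
  unfold Literature.Analysis.FunctionSpaces.eHomSobolevSeminorm
  rw [FourierTransform.fourier_smul]
  have h := Lp.coeFn_smul a (FourierTransform.fourier f : Lp ℂ³ 2 (volume : Measure ℝ³))
  have hcongr : (fun ξ : ℝ³ => ‖ξ‖ₑ ^ (2 * s) *
      ‖((a • FourierTransform.fourier f : Lp ℂ³ 2 (volume : Measure ℝ³)) : ℝ³ → ℂ³) ξ‖ₑ ^ 2)
      =ᵐ[volume] fun ξ => ‖a‖ₑ ^ 2 * (‖ξ‖ₑ ^ (2 * s) *
        ‖((FourierTransform.fourier f : Lp ℂ³ 2 (volume : Measure ℝ³)) : ℝ³ → ℂ³) ξ‖ₑ ^ 2) := by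
    filter_upwards [h] with ξ hξ
    rw [hξ, Pi.smul_apply, enorm_smul, mul_pow]
    ring
  rw [lintegral_congr_ae hcongr, lintegral_const_mul' _ _ (by simp),
    ENNReal.mul_rpow_of_nonneg _ _ (by norm_num), ← ENNReal.rpow_natCast, ← ENNReal.rpow_mul]
  norm_num

/-- The function-level homogeneous Sobolev seminorm is absolutely homogeneous for `a ≠ 0`:
`‖a • f‖_{Ḣ^s} = ‖a‖ ‖f‖_{Ḣ^s}` (both sides are `∞` if `f ∉ L²`; BCD Def. 1.31). [folklore] -/
theorem function_eHomSobolevSeminorm_const_smul (s : ℝ) {a : ℂ} (ha : a ≠ 0) (f : ℝ³ → ℂ³) :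
    Function.eHomSobolevSeminorm s (a • f) = ‖a‖ₑ * Function.eHomSobolevSeminorm s f := by
  unfold Function.eHomSobolevSeminorm
  by_cases hf : MemLp f 2 (volume : Measure ℝ³)
  · have haf : MemLp (a • f) 2 (volume : Measure ℝ³) := hf.const_smul a
    rw [dif_pos haf, dif_pos hf, ← eHomSobolevSeminorm_const_smul, ← MemLp.toLp_const_smul]
  · have haf : ¬ MemLp (a • f) 2 (volume : Measure ℝ³) := fun h => hf <| by
      simpa [smul_smul, inv_mul_cancel₀ ha] using h.const_smul a⁻¹
    rw [dif_neg haf, dif_neg hf, ENNReal.mul_top (by simpa using ha)]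

/-- Complexification commutes with the Navier–Stokes rescaling:
`complexify ∘ (c u₀(c ·)) = c • (complexify ∘ u₀)(c ·)`. [folklore] -/
theorem complexify_comp_rescaleData (u₀ : ℝ³ → ℝ³) (c : ℝ) :
    complexify ∘ FluidPDE.rescaleData c u₀ = (c : ℂ) • fun x => (complexify ∘ u₀) (c • x) := by
  funext x
  simp only [Function.comp_apply, rescaleData_apply, map_smul, Pi.smul_apply]
  rw [Complex.coe_smul]

/-- **ns.S16** (`Ḣ^{1/2}(ℝ³)` is critical; Koch–Tataru 2001 §1; BCD remark after Def. 1.31).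
The homogeneous Sobolev seminorm of order `1/2` is invariant under the Navier–Stokes scaling of
data: `‖c u₀(c ·)‖_{Ḣ^{1/2}} = c · c^{1/2 - 3/2} ‖u₀‖_{Ḣ^{1/2}} = ‖u₀‖_{Ḣ^{1/2}}` for `c > 0`.
Derived from the scaling fact `Literature.Analysis.FunctionSpaces.eHomSobolevSeminorm_comp_smul` of `FourierSobolevNorm`
(hypothesis `hsc`) and homogeneity (`function_eHomSobolevSeminorm_const_smul`). The real field
enters through `complexify`; if `u₀ ∉ L²` both sides are `∞`. [cite: KochTataru2001, §1] -/
theorem eHomSobolevSeminorm_half_rescaleData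
    (hsc : FunctionSpaces.eHomSobolevSeminorm_comp_smul (E := ℝ³) (F := ℂ³)) (u₀ : ℝ³ → ℝ³) {c : ℝ}
    (hc : 0 < c) :
    Function.eHomSobolevSeminorm (1 / 2 : ℝ) (complexify ∘ FluidPDE.rescaleData c u₀) =
      Function.eHomSobolevSeminorm (1 / 2 : ℝ) (complexify ∘ u₀) := by
  have hc' : (c : ℂ) ≠ 0 := by exact_mod_cast hc.ne'
  rw [complexify_comp_rescaleData, function_eHomSobolevSeminorm_const_smul _ hc',
    hsc (1 / 2 : ℝ) (complexify ∘ u₀) hc, finrank_euclideanSpace_fin, ← mul_assoc]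
  conv_rhs => rw [← one_mul (Function.eHomSobolevSeminorm _ _)]
  congr 1
  have he : ‖(c : ℂ)‖ₑ = ENNReal.ofReal c := by
    rw [enorm_eq_nnnorm, Complex.nnnorm_real, ← enorm_eq_nnnorm, Real.enorm_eq_ofReal hc.le]
  rw [he, ← ENNReal.ofReal_mul hc.le, ← ENNReal.ofReal_one]
  congr 1
  norm_num
  rw [Real.rpow_neg_one, mul_inv_cancel₀ hc.ne']

/-! ### `L³` -/

/-- **ns.S16** (`L³(ℝ³)` is critical; Cannone 1995, Koch–Tataru 2001 §1). The `L³` norm is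
invariant under the Navier–Stokes scaling of data:
`‖c u₀(c ·)‖_{L³} = c · c^{-3/3} ‖u₀‖_{L³} = ‖u₀‖_{L³}` for `c > 0`. Proof: change of variables
`Measure.map_addHaar_smul` and `eLpNorm_const_smul`. [cite: KochTataru2001, §1] -/
theorem eLpNorm_three_rescaleData (u₀ : ℝ³ → ℝ³) {c : ℝ} (hc : 0 < c) :
    eLpNorm (rescaleData c u₀) 3 volume = eLpNorm u₀ 3 volume := by
  have hmeas : MeasurableEmbedding (fun x : ℝ³ => c • x) :=
    (Homeomorph.smulOfNeZero c hc.ne').measurableEmbedding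
  have h1 : rescaleData c u₀ = c • (u₀ ∘ fun x : ℝ³ => c • x) := rfl
  rw [h1, eLpNorm_const_smul, ← hmeas.eLpNorm_map_measure, Measure.map_addHaar_smul _ hc.ne',
    eLpNorm_smul_measure_of_ne_top (by norm_num), finrank_euclideanSpace_fin, smul_eq_mul,
    ← mul_assoc]
  conv_rhs => rw [← one_mul (eLpNorm u₀ 3 volume)]
  congr 1
  rw [abs_of_pos (by positivity), Real.enorm_eq_ofReal hc.le, ENNReal.toReal_div,
    ENNReal.toReal_one, ENNReal.toReal_ofNat, ENNReal.ofReal_rpow_of_pos (by positivity),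
    ← ENNReal.ofReal_mul hc.le, Real.inv_rpow (by positivity), ← Real.rpow_natCast,
    ← Real.rpow_mul hc.le]
  norm_num [hc.ne']

/-- **ns.S16** (`L³(ℝ³)` is critical, membership form; Cannone 1995, Koch–Tataru 2001 §1). [cite: KochTataru2001, §1] -/
theorem memLp_three_rescaleData {u₀ : ℝ³ → ℝ³} (hu : MemLp u₀ 3 volume) {c : ℝ} (hc : 0 < c) :
    MemLp (rescaleData c u₀) 3 volume :=
  ⟨(hu.aestronglyMeasurable.comp_quasiMeasurePreserving
      (Measure.quasiMeasurePreserving_smul volume hc.ne')).const_smul c,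
    by rw [eLpNorm_three_rescaleData u₀ hc]; exact hu.eLpNorm_lt_top⟩

/-! ### `Ḃ^{-1+3/p}_{p,q}`: homogeneity of the Littlewood–Paley norms under scalars -/

section BesovHomogeneity

variable {F : Type*} [NormedAddCommGroup F] [NormedSpace ℂ F] [CompleteSpace F]

/-- The embedding `L^p → 𝓢'` is `ℂ`-linear (Mathlib's `Lp.toTemperedDistributionCLM`). [folklore] -/
theorem coe_smul_Lp {p : ℝ≥0∞} [Fact (1 ≤ p)] (a : ℂ) (f : Lp F p (volume : Measure ℝ³)) :
    ((a • f : Lp F p (volume : Measure ℝ³)) : 𝓢'(ℝ³, F)) = a • (f : 𝓢'(ℝ³, F)) := by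
  rw [← Lp.toTemperedDistributionCLM_apply, map_smul, Lp.toTemperedDistributionCLM_apply]

/-- Sub-homogeneity of the distributional `L^p` norm: `‖a • u‖_{L^p} ≤ ‖a‖ ‖u‖_{L^p}`
(BCD §1.1). [folklore] -/
theorem eLpNormDistrib_smul_le {p : ℝ≥0∞} [Fact (1 ≤ p)] (a : ℂ) (u : 𝓢'(ℝ³, F)) :
    FunctionSpaces.eLpNormDistrib p (a • u) ≤ ‖a‖ₑ * FunctionSpaces.eLpNormDistrib p u := by
  by_cases ha : a = 0
  · simp [ha, FunctionSpaces.eLpNormDistrib_zero]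
  have ha' : ‖a‖ₑ ≠ 0 := by simpa using ha
  rw [mul_comm, ← ENNReal.div_le_iff_le_mul (Or.inl ha') (Or.inl enorm_ne_top)]
  refine le_iInf₂ fun f hf => ?_
  rw [ENNReal.div_le_iff_le_mul (Or.inl ha') (Or.inl enorm_ne_top)]
  calc FunctionSpaces.eLpNormDistrib p (a • u) ≤ ‖a • f‖ₑ :=
        iInf₂_le_of_le (a • f) (by rw [coe_smul_Lp, hf]) le_rfl
    _ = ‖f‖ₑ * ‖a‖ₑ := by rw [enorm_smul, mul_comm]

/-- Homogeneity of the distributional `L^p` norm: `‖a • u‖_{L^p} = ‖a‖ ‖u‖_{L^p}` for `a ≠ 0`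
(BCD §1.1). [folklore] -/
theorem eLpNormDistrib_smul {p : ℝ≥0∞} [Fact (1 ≤ p)] {a : ℂ} (ha : a ≠ 0) (u : 𝓢'(ℝ³, F)) :
    FunctionSpaces.eLpNormDistrib p (a • u) = ‖a‖ₑ * FunctionSpaces.eLpNormDistrib p u := by
  refine le_antisymm (eLpNormDistrib_smul_le a u) ?_
  have h := eLpNormDistrib_smul_le (p := p) a⁻¹ (a • u)
  rw [smul_smul, inv_mul_cancel₀ ha, one_smul, enorm_inv ha] at h
  have ha0 : ‖a‖ₑ ≠ 0 := by simpa using ha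
  calc ‖a‖ₑ * FunctionSpaces.eLpNormDistrib p u ≤ ‖a‖ₑ * (‖a‖ₑ⁻¹ * FunctionSpaces.eLpNormDistrib p (a • u)) := by gcongr
    _ = FunctionSpaces.eLpNormDistrib p (a • u) := by
        rw [← mul_assoc, ENNReal.mul_inv_cancel ha0 enorm_ne_top, one_mul]

/-- Homogeneity of the weighted dyadic blocks `2^{js} ‖Δ̇_j (a • u)‖_{L^p} = ‖a‖ 2^{js} ‖Δ̇_j u‖_{L^p}`
for `a ≠ 0` (BCD Def. 2.15). [folklore] -/
theorem lpBlockWeight_smul (s : ℝ) {p : ℝ≥0∞} [Fact (1 ≤ p)] {a : ℂ} (ha : a ≠ 0)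
    (u : 𝓢'(ℝ³, F)) (j : ℤ) :
    FunctionSpaces.lpBlockWeight s p (a • u) j = ‖a‖ₑ * FunctionSpaces.lpBlockWeight s p u j := by
  simp only [FunctionSpaces.lpBlockWeight, map_smul, eLpNormDistrib_smul ha, mul_left_comm]

/-- `ℓ^q(ℤ)` norms of `ℝ≥0∞`-valued sequences are homogeneous under a finite constant. [folklore] -/
theorem eLpNorm_count_const_mul {c : ℝ≥0∞} (hc : c ≠ ∞) (w : ℤ → ℝ≥0∞) (q : ℝ≥0∞) :
    eLpNorm (fun j => c * w j) q Measure.count = c * eLpNorm w q Measure.count := by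
  by_cases hq0 : q = 0
  · simp [hq0]
  by_cases hqt : q = ∞
  · simp only [hqt, eLpNorm_exponent_top, eLpNormEssSup, enorm_eq_self]
    exact ENNReal.essSup_const_mul
  have hq : 0 < q.toReal := ENNReal.toReal_pos hq0 hqt
  rw [eLpNorm_eq_lintegral_rpow_enorm_toReal hq0 hqt,
    eLpNorm_eq_lintegral_rpow_enorm_toReal hq0 hqt]
  simp only [enorm_eq_self]
  simp_rw [ENNReal.mul_rpow_of_nonneg _ _ hq.le]
  rw [lintegral_const_mul' _ _ (ENNReal.rpow_ne_top_of_nonneg hq.le hc),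
    ENNReal.mul_rpow_of_nonneg _ _ (by positivity), ← ENNReal.rpow_mul,
    mul_one_div_cancel hq.ne', ENNReal.rpow_one]

/-- Homogeneity of the homogeneous Besov norm: `‖a • u‖_{Ḃ^s_{p,q}} = ‖a‖ ‖u‖_{Ḃ^s_{p,q}}` for
`a ≠ 0` (BCD Def. 2.15). [folklore] -/
theorem eHomBesovNorm_smul (s : ℝ) (p q : ℝ≥0∞) [Fact (1 ≤ p)] {a : ℂ} (ha : a ≠ 0)
    (u : 𝓢'(ℝ³, F)) :
    FunctionSpaces.eHomBesovNorm s p q (a • u) = ‖a‖ₑ * FunctionSpaces.eHomBesovNorm s p q u := by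
  unfold FunctionSpaces.eHomBesovNorm
  have h : FunctionSpaces.lpBlockWeight s p (a • u) = fun j => ‖a‖ₑ * FunctionSpaces.lpBlockWeight s p u j := by
    funext j; rw [lpBlockWeight_smul s ha]
  rw [h, eLpNorm_count_const_mul enorm_ne_top]

/-- `Ḃ^s_{p,q}` is stable under scalars (BCD Def. 2.15; both the norm and the realisation
condition `Ṡ_j u → 0` are homogeneous). [folklore] -/
theorem memHomBesov_smul {s : ℝ} {p q : ℝ≥0∞} [Fact (1 ≤ p)] (a : ℂ) {u : 𝓢'(ℝ³, F)}
    (hu : FunctionSpaces.MemHomBesov s p q u) : FunctionSpaces.MemHomBesov s p q (a • u) := by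
  by_cases ha : a = 0
  · rw [ha, zero_smul]
    exact ⟨by simp, by simp⟩
  refine ⟨?_, ?_⟩
  · rw [eHomBesovNorm_smul s p q ha]
    exact ENNReal.mul_lt_top enorm_lt_top hu.1
  · have h2 := hu.2.const_smul a
    simpa only [map_smul, smul_zero] using h2

/-- **ns.S16** (`Ḃ^{-1+3/p}_{p,q}(ℝ³)` is critical; Koch–Tataru 2001 §1; BCD Prop. 2.18 /
Rem. 2.19). The homogeneous Besov norm of index `-1 + 3/p` is invariant under the dyadic
Navier–Stokes rescalings `U ↦ 2^{j₀} U(2^{j₀} ·)` of a tempered distribution on `ℝ³` (values in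
any complex Banach space): `2^{j₀} · 2^{j₀((-1+3/p) - 3/p)} = 1`. Derived from the dilation fact
`Literature.Analysis.FunctionSpaces.eHomBesovNorm_distribDilate` of `LittlewoodPaley` (hypothesis `hdil`) and homogeneity
(`eHomBesovNorm_smul`). Exact equality holds for dyadic scales only (for general `c > 0` up to
constants, BCD Rem. 2.19). For `p = ∞`, `p.toReal = 0` and the index is `-1` (`Ḃ^{-1}_{∞,q}`), as
it should be. [cite: KochTataru2001, §1] -/
theorem eHomBesovNorm_rescaleData (hdil : FunctionSpaces.eHomBesovNorm_distribDilate (E := ℝ³) (F := F))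
    (p q : ℝ≥0∞) [Fact (1 ≤ p)] (j₀ : ℤ) (U : 𝓢'(ℝ³, F)) :
    FunctionSpaces.eHomBesovNorm (-1 + 3 / p.toReal) p q
        (rescaleDistrib (Units.mk0 ((2 : ℝ) ^ j₀) (zpow_ne_zero j₀ two_ne_zero)) U) =
      FunctionSpaces.eHomBesovNorm (-1 + 3 / p.toReal) p q U := by
  have h2 : (0 : ℝ) < (2 : ℝ) ^ j₀ := zpow_pos two_pos j₀
  have hne : (((Units.mk0 ((2 : ℝ) ^ j₀) (zpow_ne_zero j₀ two_ne_zero) : ℝˣ) : ℝ) : ℂ) ≠ 0 := by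
    rw [Units.val_mk0]
    exact_mod_cast h2.ne'
  rw [rescaleDistrib_apply, eHomBesovNorm_smul _ _ _ hne, hdil, finrank_euclideanSpace_fin,
    ← mul_assoc, Units.val_mk0]
  conv_rhs => rw [← one_mul (FunctionSpaces.eHomBesovNorm _ _ _ _)]
  congr 1
  have he : ‖(((2 : ℝ) ^ j₀ : ℝ) : ℂ)‖ₑ = (2 : ℝ≥0∞) ^ (j₀ : ℝ) := by
    rw [enorm_eq_nnnorm, Complex.nnnorm_real, ← enorm_eq_nnnorm, Real.enorm_eq_ofReal h2.le,
      ← Real.rpow_intCast, ← ENNReal.ofReal_rpow_of_pos two_pos, ENNReal.ofReal_ofNat]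
  rw [he, ← ENNReal.rpow_add _ _ (by norm_num) (by norm_num),
    show (j₀ : ℝ) + (j₀ : ℝ) * (-1 + 3 / p.toReal - (3 : ℕ) / p.toReal) = 0 by push_cast; ring,
    ENNReal.rpow_zero]

/-- **ns.S16** (`Ḃ^{-1+3/p}_{p,q}(ℝ³)` is critical, membership form; BCD Prop. 2.18). Derived from
the dilation fact `Literature.Analysis.FunctionSpaces.MemHomBesov.distribDilate` of `LittlewoodPaley` (hypothesis `hdil`) and
`memHomBesov_smul`. [cite: BahouriCheminDanchin2011, Prop. 2.18] -/
theorem memHomBesov_rescaleData (hdil : FunctionSpaces.MemHomBesov.distribDilate (E := ℝ³) (F := F))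
    {p q : ℝ≥0∞} [Fact (1 ≤ p)] {U : 𝓢'(ℝ³, F)} (hU : FunctionSpaces.MemHomBesov (-1 + 3 / p.toReal) p q U)
    (j₀ : ℤ) :
    FunctionSpaces.MemHomBesov (-1 + 3 / p.toReal) p q
      (rescaleDistrib (Units.mk0 ((2 : ℝ) ^ j₀) (zpow_ne_zero j₀ two_ne_zero)) U) := by
  rw [rescaleDistrib_apply]
  exact memHomBesov_smul _ (hdil hU j₀)

end BesovHomogeneity

/-! ### `BMO⁻¹` -/

/-- **ns.S16** (`BMO⁻¹(ℝ³)` is critical; Koch–Tataru 2001, §1: "both `BMO⁻¹` and the equations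
are invariant with respect to this scaling"). The `BMO⁻¹` norm of every component `⟪u₀, v⟫` is
invariant under `u₀ ↦ c u₀(c ·)`, `c > 0`: if `⟪u₀, v⟫ = div Φ` then
`⟪c u₀(c ·), v⟫ = div (Φ(c ·))` and `‖Φ(c ·)‖_{BMO} = ‖Φ‖_{BMO}`. [cite: KochTataru2001, §1] -/
def eBMOInvNorm_rescaleData : Prop :=
  ∀ (u₀ : ℝ³ → ℝ³) {c : ℝ} (hc : 0 < c) (v : ℝ³),
    FunctionSpaces.eBMOInvNorm (fun x => ⟪rescaleData c u₀ x, v⟫) = FunctionSpaces.eBMOInvNorm (fun x => ⟪u₀ x, v⟫)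

/-- **ns.S16** (`BMO⁻¹(ℝ³)` is critical, membership form; Koch–Tataru 2001, §1). Derived from
the norm invariance fact `eBMOInvNorm_rescaleData` (hypothesis `hnorm`) and the fact
`Literature.Analysis.FunctionSpaces.memBMOInv_iff_eBMOInvNorm_lt_top` of `BMO` (hypothesis `hiff`). [cite: KochTataru2001, §1] -/
theorem memBMOInvVec_rescaleData (hnorm : eBMOInvNorm_rescaleData)
    (hiff : FunctionSpaces.memBMOInv_iff_eBMOInvNorm_lt_top (E := ℝ³)) {u₀ : ℝ³ → ℝ³} (hu : FunctionSpaces.MemBMOInvVec u₀)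
    {c : ℝ} (hc : 0 < c) : FunctionSpaces.MemBMOInvVec (FluidPDE.rescaleData c u₀) :=
  fun v => hiff.2 (by rw [hnorm u₀ hc v]; exact hiff.1 (hu v))

end Invariance

/-! ## The chain `Ḣ^{1/2} ⊂ L³ ⊂ Ḃ^{-1+3/p}_{p,∞} ⊂ BMO⁻¹ ⊂ Ḃ^{-1}_{∞,∞}` on `ℝ³` -/

section Chain

/-- Local notation for physical space `ℝ³ = EuclideanSpace ℝ (Fin 3)`. -/
local notation "ℝ³" => EuclideanSpace ℝ (Fin 3)

/-- Local notation for the complexified target `ℂ³ = EuclideanSpace ℂ (Fin 3)`. -/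
local notation "ℂ³" => EuclideanSpace ℂ (Fin 3)

open FunctionSpaces.EuclideanSpace (complexify)

/-- A function in `Ḣ^s ∩ L²` (`Literature.Analysis.FunctionSpaces.MemHomSobolev`) has finite function-level `Ḣ^s` seminorm
(unfolding of the two definitions of `FourierSobolevNorm`; BCD Def. 1.31). [folklore] -/
theorem eHomSobolevSeminorm_lt_top_of_memHomSobolev {s : ℝ} {f : ℝ³ → ℂ³}
    (hf : FunctionSpaces.MemHomSobolev s f) : Function.eHomSobolevSeminorm s f < ∞ := by
  obtain ⟨h2, hF⟩ := hf
  unfold Function.eHomSobolevSeminorm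
  rw [dif_pos h2]
  unfold Literature.Analysis.FunctionSpaces.eHomSobolevSeminorm
  refine ENNReal.rpow_lt_top_of_nonneg (by norm_num) (ne_of_lt ?_)
  have hlt := lintegral_rpow_enorm_lt_top_of_eLpNorm_lt_top two_ne_zero ENNReal.ofNat_ne_top
    hF.eLpNorm_lt_top
  rw [FunctionSpaces.homSobolevMeasure_def, lintegral_withDensity_eq_lintegral_mul₀
    (f := fun ξ : ℝ³ => ‖ξ‖ₑ ^ (2 * s)) (measurable_enorm.pow_const _).aemeasurable
    ((Lp.aestronglyMeasurable _).enorm.pow_const _)] at hlt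
  simpa only [Pi.mul_apply, ENNReal.toReal_ofNat, ENNReal.rpow_ofNat] using hlt

/-- **ns.S16** (`Ḣ^{1/2}(ℝ³) ⊂ L³(ℝ³)`, qualitative form of the critical Sobolev embedding, BCD
Thm. 1.38 with `d = 3`, `s = 1/2`; Koch–Tataru 2001 §1). A vector field `u₀ ∈ Ḣ^{1/2} ∩ L²`
(membership of `complexify ∘ u₀`, see `Literature.Analysis.FunctionSpaces.MemHomSobolev`) lies in `L³`. Derived from the
quantitative fact `Literature.Analysis.FunctionSpaces.eLpNorm_three_le_eHomSobolevSeminorm_half` of `FourierSobolevNorm`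
(hypothesis `hemb`, at universe `0`), `‖complexify v‖ = ‖v‖` and
`eHomSobolevSeminorm_lt_top_of_memHomSobolev`. [cite: KochTataru2001, §1] -/
theorem memLp_three_of_memHomSobolev_half (hemb : FunctionSpaces.eLpNorm_three_le_eHomSobolevSeminorm_half.{0})
    {u₀ : ℝ³ → ℝ³} (hu : FunctionSpaces.MemHomSobolev (1 / 2 : ℝ) (complexify ∘ u₀)) : MemLp u₀ 3 volume := by
  obtain ⟨C, hC⟩ := @hemb ℂ³ _ _ _
  obtain ⟨h2, -⟩ := id hu
  have hmeas : AEStronglyMeasurable u₀ volume :=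
    (complexify (ι := Fin 3)).isometry.isEmbedding.aestronglyMeasurable_comp_iff.1
      h2.aestronglyMeasurable
  refine ⟨hmeas, ?_⟩
  have h3 : eLpNorm (fun x => complexify (u₀ x)) 3 volume < ∞ :=
    (hC _ h2).trans_lt (ENNReal.mul_lt_top (by simp)
      (eHomSobolevSeminorm_lt_top_of_memHomSobolev hu))
  rwa [eLpNorm_congr_norm_ae
    (Filter.Eventually.of_forall fun x => FunctionSpaces.EuclideanSpace.norm_complexify (u₀ x))] at h3

/-- **ns.S16** (`L³(ℝ³) ⊂ Ḃ^{-1+3/p}_{p,∞}(ℝ³)` for `3 < p < ∞`; Cannone 1995 (Cannone 2004,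
Handbook, §7 Lemma), Koch–Tataru 2001 §1; Bernstein/Besov embedding BCD Prop. 2.20 with
`L³ ⊂ Ḃ^0_{3,∞}`, BCD Thm. 2.34/Prop. 2.39). If `u₀ ∈ L³` and `U` is its tempered distribution
(`IsDistributionOf`, which exists by `exists_isDistributionOf_of_memLp_three`), then
`U ∈ Ḃ^{-1+3/p}_{p,∞}`. [cite: Cannone2004, §7 Lemma] -/
def memHomBesov_of_memLp_three : Prop :=
  ∀ {p : ℝ≥0∞} [Fact (1 ≤ p)] (hp₃ : 3 < p) (hp : p < ∞) {u₀ : ℝ³ → ℝ³} (hu : MemLp u₀ 3 volume) {U : 𝓢'(ℝ³, ℂ³)} (hU : IsDistributionOf u₀ U),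
    FunctionSpaces.MemHomBesov (-1 + 3 / p.toReal) p ∞ U

/-- **ns.S16** (`Ḃ^{-1+3/p}_{p,∞}(ℝ³) ⊂ BMO⁻¹(ℝ³)` for `p < ∞`; Koch–Tataru 2001, §1, via the
Carleson-measure characterisation of `BMO⁻¹`, Koch–Tataru Thm. 1; Cannone 2004, Handbook, §7).
If `U ∈ Ḃ^{-1+3/p}_{p,∞}` is the tempered distribution of the vector field `u₀ : ℝ³ → ℝ³`, then
every component of `u₀` lies in `BMO⁻¹` (`Literature.Analysis.FunctionSpaces.MemBMOInvVec`). The hypothesis `IsDistributionOf`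
forces `u₀` to be a locally integrable function, as `Literature.Analysis.FunctionSpaces.MemBMOInv` requires. The sources state
the inclusion for `3 < p < ∞`; the statement here covers every `1 ≤ p < ∞`, the extension to
`p ≤ 3` being by the Bernstein/Besov embedding `Ḃ^{-1+3/p}_{p,∞} ⊂ Ḃ^{-1+3/r}_{r,∞}` (`p ≤ r`,
BCD Prop. 2.20, `Literature.Analysis.FunctionSpaces.MemHomBesov.of_exponent_le` / `Literature.Analysis.FunctionSpaces.besov_embedding`) followed by the case
`r > 3`. [cite: KochTataru2001, Thm. 1] -/
def memBMOInv_of_memHomBesov : Prop :=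
  ∀ {p : ℝ≥0∞} [Fact (1 ≤ p)] (hp : p < ∞) {u₀ : ℝ³ → ℝ³} {U : 𝓢'(ℝ³, ℂ³)} (hU : IsDistributionOf u₀ U) (h : FunctionSpaces.MemHomBesov (-1 + 3 / p.toReal) p ∞ U),
    FunctionSpaces.MemBMOInvVec u₀

/-- **ns.S16** (`BMO⁻¹(ℝ³) ⊂ Ḃ^{-1}_{∞,∞}(ℝ³)`; Koch–Tataru 2001, §1; BCD end of §2.3 /
Prop. 2.39). If every component of `u₀ : ℝ³ → ℝ³` is in `BMO⁻¹` and `U` is the tempered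
distribution of `u₀`, then `U ∈ Ḃ^{-1}_{∞,∞}`. This is the vector form of the accepted scalar
statement `Literature.Analysis.FunctionSpaces.MemBMOInv.memHomBesov_neg_one_top`. [cite: KochTataru2001, §1] -/
def memHomBesov_neg_one_top_of_memBMOInv : Prop :=
  ∀ {u₀ : ℝ³ → ℝ³} (hu : FunctionSpaces.MemBMOInvVec u₀) {U : 𝓢'(ℝ³, ℂ³)} (hU : IsDistributionOf u₀ U),
    FunctionSpaces.MemHomBesov (-1) ∞ ∞ U

/-- **ns.S16** (strictness `L³ ⊊ Ḃ^{-1+3/p}_{p,∞}`; Cannone 1995 / Cannone 2004, Handbook, §7: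
the homogeneous field `‖x‖⁻¹` of degree `-1` is scale invariant, belongs to `Ḃ^{-1+3/p}_{p,∞}(ℝ³)`
for `3 < p`, but not to `L³(ℝ³)`; context: Bourgain–Pavlović 2008, §1). There is a vector field
on `ℝ³` with a tempered distribution in `Ḃ^{-1+3/p}_{p,∞}` for all `3 < p < ∞` which is not in
`L³`. [cite: Cannone2004, §7] -/
def exists_memHomBesov_and_not_memLp_three : Prop :=
  ∃ (u₀ : ℝ³ → ℝ³) (U : 𝓢'(ℝ³, ℂ³)), IsDistributionOf u₀ U ∧
      (∀ (p : ℝ≥0∞) [Fact (1 ≤ p)], 3 < p → p < ∞ → FunctionSpaces.MemHomBesov (-1 + 3 / p.toReal) p ∞ U) ∧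
      ¬ MemLp u₀ 3 volume

end Chain

end Literature.Analysis.FluidPDE
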